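import Literature.Computability.MetaComplexity.Resolution
import Literature.Computability.MetaComplexity.ResolutionProofs
import Literature.Computability.MetaComplexity.ResolutionWidth
import HarnessLib

/-!
# Step lists: content-addressed resolution derivations with built-in weakening

A bookkeeping layer over the tree's resolution calculus (`Resolution.lean`: a derivation
`π : List (ResLine ν)` is a list of lines whose premises are *positions* of earlier lines). To
construct an explicit polynomial-length refutation (e.g. Pudlák's refutation of `RREF(F,s)`,
[Atserias–Müller 2020, Lemma 11], file `RefutationCNFUpper.lean`) it is far more convenient to
refer to premises by *content*: we list the clauses to be derived, in order, and check that each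
one is obtained from axioms and *earlier members of the list* by one of the two weakened rules

* `DerivStep A C`: `C` is a weakening of a clause of `A`, or a weakening of a resolvent of two
  clauses of `A` (`A` = the clauses available so far);
* `StepList A L`: the members of `L`, left to right, each satisfy `DerivStep` with respect to `A`
  enlarged by the members before it.

`StepList.exists_isResDerivation` turns a step list over `clauseSet φ` into a genuine
`IsResDerivation φ π` realizing every member of the list, with `π.length ≤ 4 · L.length` (a step
costs at most two `initial` lines, one `resolve` line and one `weaken` line), and
`StepList.minResRefutationSize_le` bounds the minimal refutation size by `4 · |L|` when `∅ ∈ L`.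
Composition lemmas (`StepList.append`, `stepList_map_range`, monotonicity) let blocks of clauses
indexed by ranges be verified one index at a time.

## References

* J. Krajíček, *Proof Complexity*, CUP 2019, §5.1 (resolution with the weakening rule; size).
* A. Atserias, M. Müller, *Automating Resolution is NP-hard*, J. ACM 67(5) (2020), proof of
  Lemma 11 (the refutation is described clause by clause, premises named by content).
-/

namespace Literature.Computability.MetaComplexity

open Complexity

variable {ν : Type*} [DecidableEq ν]

/-! ### One step, and lists of steps -/

/-- `DerivStep A C`: the set-clause `C` follows from the available clauses `A` in one weakened
step — `C` is a superset of some `D ∈ A` (weakening), or a superset of the resolvent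
`(D ∖ {v}) ∪ (E ∖ {¬v})` of some `D ∋ v` and `E ∋ ¬v` in `A` (resolution followed by weakening).
[Krajíček 2019, §5.1 (resolution rule, weakening rule)] [folklore] -/
def DerivStep (A : Set (Finset (Literal ν))) (C : Finset (Literal ν)) : Prop :=
  (∃ D ∈ A, D ⊆ C) ∨
    ∃ D ∈ A, ∃ E ∈ A, ∃ v : ν, (v, true) ∈ D ∧ (v, false) ∈ E ∧
      D.erase (v, true) ⊆ C ∧ E.erase (v, false) ⊆ C

/-- `StepList A L`: the clauses of `L`, in order, are each obtained by a `DerivStep` from `A`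
together with the members of `L` before them (a resolution derivation with premises named by
content rather than by position). [Krajíček 2019, §5.1 (R-derivations)] [folklore] -/
def StepList : Set (Finset (Literal ν)) → List (Finset (Literal ν)) → Prop
  | _, [] => True
  | A, C :: L => DerivStep A C ∧ StepList (insert C A) L

/-- Unfolding `StepList` on the empty list. [folklore] -/
@[simp] theorem stepList_nil (A : Set (Finset (Literal ν))) : StepList A [] := trivial

/-- Unfolding `StepList` on a cons. [folklore] -/
theorem stepList_cons {A : Set (Finset (Literal ν))} {C : Finset (Literal ν)}
    {L : List (Finset (Literal ν))} :
    StepList A (C :: L) ↔ DerivStep A C ∧ StepList (insert C A) L := Iff.rfl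

/-- A weakening of an available clause is a step. [folklore] -/
theorem DerivStep.of_mem {A : Set (Finset (Literal ν))} {C D : Finset (Literal ν)} (hD : D ∈ A)
    (hDC : D ⊆ C) : DerivStep A C :=
  Or.inl ⟨D, hD, hDC⟩

/-- A weakening of a resolvent of two available clauses is a step. [folklore] -/
theorem DerivStep.of_res {A : Set (Finset (Literal ν))} {C D E : Finset (Literal ν)} {v : ν}
    (hD : D ∈ A) (hE : E ∈ A) (hvD : (v, true) ∈ D) (hvE : (v, false) ∈ E)
    (h₁ : D.erase (v, true) ⊆ C) (h₂ : E.erase (v, false) ⊆ C) : DerivStep A C :=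
  Or.inr ⟨D, hD, E, hE, v, hvD, hvE, h₁, h₂⟩

/-- Steps are monotone in the available clauses. [folklore] -/
theorem DerivStep.mono {A B : Set (Finset (Literal ν))} {C : Finset (Literal ν)}
    (h : DerivStep A C) (hAB : A ⊆ B) : DerivStep B C := by
  rcases h with ⟨D, hD, hDC⟩ | ⟨D, hD, E, hE, v, hvD, hvE, h₁, h₂⟩
  · exact .of_mem (hAB hD) hDC
  · exact .of_res (hAB hD) (hAB hE) hvD hvE h₁ h₂

/-- Steps are closed under further weakening of the conclusion. [folklore] -/
theorem DerivStep.weaken {A : Set (Finset (Literal ν))} {C C' : Finset (Literal ν)}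
    (h : DerivStep A C) (hCC' : C ⊆ C') : DerivStep A C' := by
  rcases h with ⟨D, hD, hDC⟩ | ⟨D, hD, E, hE, v, hvD, hvE, h₁, h₂⟩
  · exact .of_mem hD (hDC.trans hCC')
  · exact .of_res hD hE hvD hvE (h₁.trans hCC') (h₂.trans hCC')

/-- Step lists are monotone in the available clauses. [folklore] -/
theorem StepList.mono {A B : Set (Finset (Literal ν))} {L : List (Finset (Literal ν))}
    (h : StepList A L) (hAB : A ⊆ B) : StepList B L := by
  induction L generalizing A B with
  | nil => trivial
  | cons C L ih =>
    exact ⟨h.1.mono hAB, ih h.2 (Set.insert_subset_insert hAB)⟩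

/-- Concatenation of step lists: the second block may use the clauses of the first.
[folklore] -/
theorem StepList.append {A : Set (Finset (Literal ν))} {L₁ L₂ : List (Finset (Literal ν))}
    (h₁ : StepList A L₁) (h₂ : StepList (A ∪ {C | C ∈ L₁}) L₂) : StepList A (L₁ ++ L₂) := by
  induction L₁ generalizing A with
  | nil =>
    simpa using h₂
  | cons C L₁ ih =>
    refine ⟨h₁.1, ih h₁.2 (h₂.mono ?_)⟩
    intro D hD
    rcases hD with hD | hD
    · exact Or.inl (Set.mem_insert_of_mem _ hD)
    · rcases List.mem_cons.1 hD with rfl | hD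
      · exact Or.inl (Set.mem_insert _ _)
      · exact Or.inr hD

/-- A block indexed by a range is a step list as soon as its `j`-th clause steps from the
available clauses together with the clauses of index `< j`. [folklore] -/
theorem stepList_map_range {A : Set (Finset (Literal ν))} {f : ℕ → Finset (Literal ν)} {k : ℕ}
    (h : ∀ j < k, DerivStep (A ∪ {C | ∃ i < j, f i = C}) (f j)) :
    StepList A ((List.range k).map f) := by
  induction k with
  | zero => simp
  | succ k ih =>
    rw [List.range_succ, List.map_append, List.map_singleton]
    refine StepList.append (ih fun j hj => h j (Nat.lt_succ_of_lt hj)) ⟨?_, trivial⟩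
    refine (h k (Nat.lt_succ_self k)).mono ?_
    rintro D (hD | ⟨i, hi, rfl⟩)
    · exact Or.inl hD
    · exact Or.inr (List.mem_map.2 ⟨i, List.mem_range.2 hi, rfl⟩)

/-- A concatenation of blocks indexed by a range is a step list as soon as its `j`-th block is a
step list over the available clauses together with the clauses of the blocks of index `< j`.
[folklore] -/
theorem stepList_flatMap_range {A : Set (Finset (Literal ν))} {g : ℕ → List (Finset (Literal ν))}
    {k : ℕ} (h : ∀ j < k, StepList (A ∪ {C | ∃ i < j, C ∈ g i}) (g j)) :
    StepList A ((List.range k).flatMap g) := by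
  induction k with
  | zero => simp
  | succ k ih =>
    rw [List.range_succ, List.flatMap_append, List.flatMap_singleton]
    refine StepList.append (ih fun j hj => h j (Nat.lt_succ_of_lt hj)) ?_
    refine (h k (Nat.lt_succ_self k)).mono ?_
    rintro D (hD | ⟨i, hi, hD⟩)
    · exact Or.inl hD
    · exact Or.inr (List.mem_flatMap.2 ⟨i, List.mem_range.2 hi, hD⟩)

/-- A singleton step list. [folklore] -/
theorem stepList_singleton {A : Set (Finset (Literal ν))} {C : Finset (Literal ν)}
    (h : DerivStep A C) : StepList A [C] := ⟨h, trivial⟩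

/-! ### Realizing step lists as derivations -/

/-- `Avail φ π D`: the clause `D` is an axiom of `φ` or the clause of some line of `π` (so a line
for it can be referenced, after at most one `initial` line). [folklore] -/
def Avail (φ : CNF ν) (π : List (ResLine ν)) (D : Finset (Literal ν)) : Prop :=
  D ∈ clauseSet φ ∨ ∃ i, ∃ hi : i < π.length, (π[i]'hi).clause = D

omit [DecidableEq ν] in
/-- Positions are stable under appending lines. [folklore] -/
theorem getElem_append_left' {π τ : List (ResLine ν)} {i : ℕ} (hi : i < π.length) :
    ∃ hi' : i < (π ++ τ).length, ((π ++ τ)[i]'hi') = π[i] :=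
  ⟨by rw [List.length_append]; omega, List.getElem_append_left hi⟩

/-- Availability is stable under appending lines. [folklore] -/
theorem Avail.append {φ : CNF ν} {π : List (ResLine ν)} {D : Finset (Literal ν)}
    (h : Avail φ π D) (τ : List (ResLine ν)) : Avail φ (π ++ τ) D := by
  rcases h with h | ⟨i, hi, hiD⟩
  · exact Or.inl h
  · obtain ⟨hi', heq⟩ := getElem_append_left' (τ := τ) hi
    exact Or.inr ⟨i, hi', by rw [heq]; exact hiD⟩

/-- An available clause sits at some position after appending at most one `initial` line.
[Krajíček 2019, §5.1 (initial clauses)] [folklore] -/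
theorem Avail.exists_position {φ : CNF ν} {π : List (ResLine ν)} {D : Finset (Literal ν)}
    (h : Avail φ π D) (hπ : IsResDerivation φ π) :
    ∃ τ : List (ResLine ν), IsResDerivation φ (π ++ τ) ∧ τ.length ≤ 1 ∧
      ∃ i, ∃ hi : i < (π ++ τ).length, ((π ++ τ)[i]'hi).clause = D := by
  rcases h with h | ⟨i, hi, hiD⟩
  · have hD : D ∈ φ.clauseFinsets := by simpa [clauseSet] using h
    refine ⟨[⟨D, .initial⟩], hπ.append_singleton (l := ⟨D, .initial⟩) hD, le_rfl,
      π.length, by simp, ?_⟩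
    rw [List.getElem_append_right le_rfl]
    simp
  · exact ⟨[], by simpa using hπ, by simp, i, by simpa using hi, by simpa using hiD⟩

/-- **Realizing one step**: if every available clause is an axiom or a line of the derivation
`π`, a `DerivStep` conclusion `C` becomes a line after appending at most four lines (two
`initial`, one `resolve`, one `weaken`). [Krajíček 2019, §5.1] [folklore] -/
theorem DerivStep.exists_append {φ : CNF ν} {A : Set (Finset (Literal ν))}
    {C : Finset (Literal ν)} (hs : DerivStep A C) (π : List (ResLine ν))
    (hπ : IsResDerivation φ π) (hA : ∀ D ∈ A, Avail φ π D) :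
    ∃ τ : List (ResLine ν), IsResDerivation φ (π ++ τ) ∧ τ.length ≤ 4 ∧
      ∃ i, ∃ hi : i < (π ++ τ).length, ((π ++ τ)[i]'hi).clause = C := by
  rcases hs with ⟨D, hD, hDC⟩ | ⟨D, hD, E, hE, v, hvD, hvE, h₁, h₂⟩
  · -- weakening of `D`
    obtain ⟨τ₁, hπ₁, hτ₁, i, hi, hiD⟩ := (hA D hD).exists_position hπ
    have hval : IsValidResLine φ (π ++ τ₁) ⟨C, .weaken i⟩ := by
      change ∃ hi : i < (π ++ τ₁).length, ((π ++ τ₁)[i]'hi).clause ⊆ C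
      exact ⟨hi, hiD ▸ hDC⟩
    refine ⟨τ₁ ++ [⟨C, .weaken i⟩], ?_, ?_, (π ++ τ₁).length, ?_, ?_⟩
    · simpa only [List.append_assoc] using hπ₁.append_singleton hval
    · simp only [List.length_append, List.length_singleton]; omega
    · simp
    · simp only [← List.append_assoc]
      rw [List.getElem_append_right le_rfl]
      simp
  · -- resolution of `D ∋ v` and `E ∋ ¬v`, then weakening
    obtain ⟨τ₁, hπ₁, hτ₁, i, hi, hiD⟩ := (hA D hD).exists_position hπ
    obtain ⟨τ₂, hπ₂, hτ₂, j, hj, hjE⟩ := ((hA E hE).append τ₁).exists_position hπ₁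
    obtain ⟨hi₂, hiD₂⟩ :
        ∃ hi' : i < (π ++ τ₁ ++ τ₂).length, ((π ++ τ₁ ++ τ₂)[i]'hi').clause = D := by
      obtain ⟨hi', heq⟩ := getElem_append_left' (τ := τ₂) hi
      exact ⟨hi', by rw [heq]; exact hiD⟩
    obtain ⟨lr, hlr⟩ : ∃ lr : ResLine ν,
        lr = ⟨D.erase (v, true) ∪ E.erase (v, false), .resolve i j v⟩ := ⟨_, rfl⟩
    obtain ⟨lw, hlw⟩ : ∃ lw : ResLine ν, lw = ⟨C, .weaken (π ++ τ₁ ++ τ₂).length⟩ := ⟨_, rfl⟩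
    have hval : IsValidResLine φ (π ++ τ₁ ++ τ₂) lr := by
      rw [hlr]
      change ∃ hi : i < (π ++ τ₁ ++ τ₂).length, ∃ hj : j < (π ++ τ₁ ++ τ₂).length,
        IsResolvent ((π ++ τ₁ ++ τ₂)[i]'hi).clause ((π ++ τ₁ ++ τ₂)[j]'hj).clause v
          (D.erase (v, true) ∪ E.erase (v, false))
      refine ⟨hi₂, hj, ?_⟩
      rw [hiD₂, hjE]
      exact ⟨hvD, hvE, rfl⟩
    have hπ₃ : IsResDerivation φ (π ++ τ₁ ++ τ₂ ++ [lr]) := hπ₂.append_singleton hval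
    have hval' : IsValidResLine φ (π ++ τ₁ ++ τ₂ ++ [lr]) lw := by
      rw [hlw]
      change ∃ hk : (π ++ τ₁ ++ τ₂).length < (π ++ τ₁ ++ τ₂ ++ [lr]).length,
        ((π ++ τ₁ ++ τ₂ ++ [lr])[(π ++ τ₁ ++ τ₂).length]'hk).clause ⊆ C
      refine ⟨by simp, ?_⟩
      rw [List.getElem_append_right le_rfl]
      simp [hlr, Finset.union_subset h₁ h₂]
    refine ⟨τ₁ ++ τ₂ ++ [lr] ++ [lw], ?_, ?_, (π ++ τ₁ ++ τ₂ ++ [lr]).length, ?_, ?_⟩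
    · simpa only [List.append_assoc] using hπ₃.append_singleton hval'
    · simp only [List.length_append, List.length_singleton]; omega
    · simp
    · simp only [← List.append_assoc]
      rw [List.getElem_append_right le_rfl]
      simp [hlw]

/-- **Realizing a step list**: a step list over available clauses extends the derivation `π` by
at most `4 · |L|` lines after which every member of `L` is the clause of some line (and the
previously available clauses stay available). [Krajíček 2019, §5.1 (R-derivations, size)]
[folklore] -/
theorem StepList.exists_append {φ : CNF ν} {A : Set (Finset (Literal ν))}
    {L : List (Finset (Literal ν))} (hL : StepList A L) (π : List (ResLine ν))
    (hπ : IsResDerivation φ π) (hA : ∀ D ∈ A, Avail φ π D) :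
    ∃ τ : List (ResLine ν), IsResDerivation φ (π ++ τ) ∧ τ.length ≤ 4 * L.length ∧
      (∀ D ∈ A, Avail φ (π ++ τ) D) ∧
      ∀ D ∈ L, ∃ i, ∃ hi : i < (π ++ τ).length, ((π ++ τ)[i]'hi).clause = D := by
  induction L generalizing A π with
  | nil =>
    exact ⟨[], by simpa using hπ, by simp, fun D hD => by simpa using hA D hD, by simp⟩
  | cons C L ih =>
    obtain ⟨τ₁, hπ₁, hτ₁, i, hi, hiC⟩ := hL.1.exists_append π hπ hA
    have hA' : ∀ D ∈ insert C A, Avail φ (π ++ τ₁) D := by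
      intro D hD
      rcases Set.mem_insert_iff.1 hD with rfl | hD
      · exact Or.inr ⟨i, hi, hiC⟩
      · exact (hA D hD).append τ₁
    obtain ⟨τ₂, hπ₂, hτ₂, hav, hall⟩ := ih hL.2 (π ++ τ₁) hπ₁ hA'
    refine ⟨τ₁ ++ τ₂, by simpa only [List.append_assoc] using hπ₂, ?_, ?_, ?_⟩
    · simp only [List.length_append, List.length_cons]; omega
    · intro D hD
      simpa only [List.append_assoc] using hav D (Set.mem_insert_of_mem _ hD)
    · intro D hD
      rcases List.mem_cons.1 hD with rfl | hD
      · obtain ⟨hi', heq⟩ := getElem_append_left' (τ := τ₂) hi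
        refine ⟨i, by simpa only [List.append_assoc] using hi', ?_⟩
        simp only [← List.append_assoc]
        rw [heq]; exact hiC
      · simpa only [List.append_assoc] using hall D hD

/-- **A step list from the axioms is realized by a derivation of length at most `4 · |L|`**
containing every member of the list. [Krajíček 2019, §5.1] [folklore] -/
theorem StepList.exists_isResDerivation {φ : CNF ν} {L : List (Finset (Literal ν))}
    (hL : StepList (clauseSet φ) L) :
    ∃ π : List (ResLine ν), IsResDerivation φ π ∧ π.length ≤ 4 * L.length ∧
      ∀ D ∈ L, ∃ l ∈ π, l.clause = D := by
  obtain ⟨τ, hτ, hlen, -, hall⟩ :=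
    hL.exists_append [] (isResDerivation_nil φ) (fun D hD => Or.inl hD)
  simp only [List.nil_append] at hτ hall
  refine ⟨τ, hτ, hlen, fun D hD => ?_⟩
  obtain ⟨i, hi, hiD⟩ := hall D hD
  exact ⟨τ[i], List.getElem_mem hi, hiD⟩

/-- **Refutations from step lists**: if the empty clause is a member of a step list over the
axioms of `φ`, then `φ` has a resolution refutation of length at most `4 · |L|`, whence
`minResRefutationSize φ ≤ 4 · |L|`. [Krajíček 2019, §5.1 (size S_R)] [folklore] -/
theorem StepList.minResRefutationSize_le {φ : CNF ν} {L : List (Finset (Literal ν))}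
    (hL : StepList (clauseSet φ) L) (hempty : (∅ : Finset (Literal ν)) ∈ L) :
    minResRefutationSize φ ≤ ((4 * L.length : ℕ) : ℕ∞) := by
  obtain ⟨π, hπ, hlen, hall⟩ := hL.exists_isResDerivation
  obtain ⟨l, hl, hl0⟩ := hall ∅ hempty
  have href : IsResRefutation φ π := ⟨hπ, l, hl, hl0⟩
  calc minResRefutationSize φ ≤ π.length := minResRefutationSize_le_length href
    _ ≤ ((4 * L.length : ℕ) : ℕ∞) := by exact_mod_cast hlen

end Literature.Computability.MetaComplexity
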